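/- Copyright: the b2b-balaban cell (near-miss cell 7), T⁴-continuum fan-out; row NE7b CRUX team (2), seat
t4-ne7b-formalise-leaf-04 (gen 34) — the located question Q-leaf04g32-1 (`CLAIMS.log` l.31550) answered by the row OWNER
t4-ne7b-p1 (gen 47, `CLAIMS.log` l.31911: «v3.1′ re-homing: YES, as an INTERFACE REQUEST → leaf-04»): the owner's
`κ := costT` witness `CountRoadWitnessT3bWTV` (p263890) RE-HOMED on the repaired END v3.1 (leaf-02's total-form W-headline
E8T `HistoryRealiseCellsRunHeadlineT3bPWT`, p259094).  Released under the licence of the surrounding project. -/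
import Summits.QuantumFields.BalabanUV.T4Continuum.Support.HistoryRealiseCellsRunApexT3bWTV
import Summits.QuantumFields.BalabanUV.T4Continuum.Support.HistoryRealiseCellsRunHeadlineT3bPWT

/-!
# Realised histories: ROW NE7b AT THE APEX AND THE HEADLINE OVER THE REPAIRED END v3.1 FROM THE `κ := costT` WITNESS —
NO DEMAND ON PRINT's CONSTANTS (the V-headline re-homed on the v3.1′ chain)

Summits-side support leaf of the T⁴-continuum cell (rung (B)+1 on a FINITE torus only; NOT infinite volume, NOT the
mass gap, NOT the Clay statement; NOT a proof of the spine estimate NE7b, which is the cell's OWN estimate, NOT PRINTED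
and NOT PROVED).  [folklore] composition by name over leaf-02's E8T
(`HistoryRealiseCellsRunHeadlineT3bPWT.hybridNE7Under_of_countRoadT3bPWT_fsc` ∕ `limit_exists_of_countRoadT3bPWT_fsc` ∕
`limit_unique_of_countRoadT3bPWT_fsc` ∕ `targets_of_countRoadT3bPWT_fsc` ∕ `continuumYM4Torus_of_countRoadT3bPWT_fsc`) and the
owner's embedding `HistoryRealiseCellsRunApexT3bWTV.CountRoadWitnessT3bWTV.toWT` (p263890); no definition, no `[cite:]` tag,
nothing printed asserted, no `Prop` fact minted, zero `sorry`.  Append-only: E8T, the owner's V-apex ∕ V-headline p263890,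
E7T and the headline of record p224237 stay, UNCHANGED BY NAME.

WHY (located point L-ne7bleaf04g32-1, question Q-leaf04g32-1, `CLAIMS.log` l.31550; owner's answer l.31911).  The owner's
V-apex ∕ V-headline (`HistoryRealiseCellsRunApexT3bWTV` §2) and, through it, leaf-02's VS-headline
(`HistoryRealiseCellsRunHeadlineT3bWTVS`, p266167) are plugged on E7T = the apex input over END v3′, whose statement carries
BOTH the class-linear slack `hslack : C.a + θ ≤ ½γ₀A₁²` AND the slot-multiplicity demand `hθJ : ΘJ(d, sS, θc) +
8·2^d·log(2d+1) ≤ θ` — together the located demand `ΘJ + 8·2^d·log(2d+1) ≤ ½γ₀A₁² − C.a` on PRINT's `O(1)` constants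
(WALL T4′; at `d = 4` the left side exceeds `4.6·10^16`: vacuous for `O(1)` printed constants).  The repaired END v3.1
(row S12j; leaf-03's W9T `HistoryRealiseCellsRunMultEndPDWT` → `…PinnedT3bPWT`, leaf-02's E8T) reads the multiplicity's
class-linear constant at the profile LEVEL `p₀` of the infrared threshold instead: E8T's statement has `hθ : 0 < θ`, the
plain slack `hslack : C.a + θ ≤ ½γ₀A₁²` and NO `hθJ` — the demand sits in the coupling threshold `g₁`, and the
constants-only side conditions are INHABITED (`HistoryRealiseCellsRunHeadlineT3bP.exists_consts_countRoadT3bP`, p224237).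
E8T's prefixed hypothesis is a `CountRoadWitnessT3bWT` — the SAME witness record E7T takes (witness records are
END-agnostic) — so the owner's `κ := costT` witness embeds into it by the landed `toWT` and the whole V-programme (M5-2 ∕
M5-3 ∕ M5-4, IR-44-1 ∕ IR-45-1 ∕ IR-46-1, the (α) assembly SPEC IR-46-2 whose §1 target is a `CountRoadWitnessT3bWTVS`)
acquires a headline WITHOUT the demand on print's constants.  This file is that re-homing at the V level; the sibling
`HistoryRealiseCellsRunHeadlineT3bPWTVS` does the VS level (split slack, weighted class remainder) through leaf-02's
`toWTV` ∕ `reslack`.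

WHAT.  §1 **`hybridNE7Under_of_countRoadT3bPWTV_fsc`** (apex input), `limit_exists_of_countRoadT3bPWTV_fsc`,
`limit_unique_of_countRoadT3bPWTV_fsc`; §2 `targets_of_countRoadT3bPWTV_fsc`, **`continuumYM4Torus_of_countRoadT3bPWTV_fsc`**
(headline): E8T's statements with `CountRoadWitnessT3bWT ↦ CountRoadWitnessT3bWTV` in the prefixed hypothesis (the ONLY
change), by `ForSmallCouplings.mono` through `toWT`; conclusions (`T4ApexHybrid.HybridNE7Under D (BetaPertHyp D.βfun)`,
`D.ym4_torus_continuum_limit_exists ∕ _unique`, the four targets, `T4ContinuumYM4Torus.ContinuumYM4Torus D`) BYTE-IDENTICAL.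
§3 one closing `example`: THE RE-HOMED V-HEADLINE IS AT LEAST AS STRONG AS THE OWNER's V-HEADLINE p263890 — from
p263890's OWN hypotheses (binders LITERALLY those of `continuumYM4Torus_of_countRoadT3bWTV_fsc`, `hθ : 0 ≤ θ` and `hθJ`
included) its conclusion follows through THIS file's headline, `hθJ` serving only to make `θ` positive (its left side is
`≥ 12`); an `example`, not a named theorem, because its statement IS p263890's.

BY-NAME EFFECT ON THE WALL (`WALL-NE7b-P1.md` §2, for the owner to record): NONE on the R∕S∕K∕C class of any binder —
the witness record is the owner's, unchanged; what changes is the END the witness is read by: the caveat of WALL T4′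
(`8·8710^d < ½γ₀A₁²`, L-ne7bleaf04g32-1) LEAVES the V-programme's headline; the constants-only side conditions of the
headline are E8T's (inhabited).  DISPLAYED, NOT DISCHARGED (unchanged list): H3^NE7b's `realised` reading, the price ∕
numerator readings `priceM upM deadM_nonneg resumM FM_nonneg` (+ primed), (B) `B16.EndStatementBPrinted`, `BetaPertHyp`,
the flow box bounds ∕ tuning ∕ IR smallness (`ForSmallCouplings`), NE7c's `ShellWeightBound`, NE7's `ReindexedBudget` +
four summable rates.  HONEST: NE7b NOT proved; spine 0∕9; rung (B)+1 finite T⁴ — NOT infinite volume, NOT mass gap, NOT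
Clay.  HONEST DEPENDENCY (cell): continuum YM on T⁴ ⇐ BetaPertH ∧ nine spine estimates (0/9 proved); BetaPertH ⇐ (D1) ∧
(D4) ∧ CAP+tail; G-an2-4 gates asym, D1 and NE2/3/4.  This file changes none of it.

v1.1 (seat t4-ne7b-formalise-leaf-04, gen 37; DOCSTRING ONLY — every declaration, binder, proof, `import` and `open` line of
v1 = p279782 is byte-identical) — SUPERSESSION-OF-RECORD MARKING (referee `t4/formal/NE7b/REFEREE.md` pass 60, OI-77 «A∕B»;
the OWNER's word W-ne7bp1-g49-2, `CLAIMS.log` l.33573).  SUPERSEDED IN PLACE (R-OWNER-48-1 «THE GUARDED CUT»): the `hData`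
prefix of the five theorems of §1–§2 is a `CountRoadWitnessT3bWTV` for all small-coupling tuned runs, and that witness (like
every W ∕ WT ∕ WTVS count-road witness) carries the field `disjointJoins`, MISSTATED AS TYPED — the unguarded display
`DisjointJoins` is unsatisfiable on non-trivial genealogies (`HistoryRealiseDistinctGuarded.Sanity.not_disjointJoins_nestedToy`)
— so the prefix is not an honest hypothesis for the (α) assembly to inhabit.  OF RECORD INSTEAD: the guarded witness
`CountRoadWitnessT3bWTVSL` (`HistoryRealiseCellsRunApexT3bWTVSL`) and the records `HistReadDataL` ∕ `HistReadDataLW`; the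
guarded headline is L3b `HistoryRealiseCellsRunHeadlineT3bPWTVSL.continuumYM4Torus_of_countRoadT3bPWTVSL_fsc` (no V-level
L-structure exists or is needed: L3b feeds leaf-02's guarded pinned END `HistoryRealiseCellsRunPinnedT3bPWTL` field by field);
the terminal theorems are `HistoryRealiseCellsRunAssemblyWTVSL.continuumYM4Torus_of_histReadingL_fsc` and its prefix twin
`HistoryRealiseCellsRunAssemblyWTVSLW.continuumYM4Torus_of_histReadingLW_fsc` (the (α) terminal theorem of record).  Module B
`HistoryRealiseCellsRunHeadlineT3bPWTVS` (which imports this file) carries the same marking; §3's `example` stays a check of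
the V-headline junction; nothing is deleted (append-only gate), importers are unaffected, no by-name class of any
WALL-NE7b-P1 §2 binder moves.  NE7b NOT proved; spine 0∕9.  HONEST DEPENDENCY: continuum YM on T⁴ ⇐ BetaPertH ∧ nine spine estimates (0/9 proved); BetaPertH ⇐ (D1) ∧ (D4) ∧ CAP+tail; G-an2-4 gates asym, D1 and NE2/3/4. -/

open Literature.MathematicalPhysics.QuantumFieldTheory.Balaban1983to89
open T4Continuum T4PrintedShapeBanking T4CanonicalMenus
open Summit.QuantumFields.BalabanUV.T4Continuum.CountThresholdUniform
open Summit.QuantumFields.BalabanUV.T4Continuum.HistoryConstants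
open Summit.QuantumFields.BalabanUV.T4Continuum.HistoryZoneEvolve (cth)
open Summit.QuantumFields.BalabanUV.T4Continuum.HistoryRealiseCellsRunApexT3bWT
open Summit.QuantumFields.BalabanUV.T4Continuum.HistoryRealiseCellsRunApexT3bWTV
open Summit.QuantumFields.BalabanUV.T4Continuum.HistoryRealiseCellsRunHeadlineT3bPWT

namespace Summit.QuantumFields.BalabanUV.T4Continuum.HistoryRealiseCellsRunApexT3bPWTV

noncomputable section

section Under

variable {F : T4Family} {G : Type*} [GaugeGroup G] [MeasurableSpace G] [HaarData G] [RegularGaugeGroup G]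

/-! ## §1 The apex input over the repaired END v3.1 from the `κ := costT` witness -/

/-- **ROW NE7b AT THE APEX OVER THE REPAIRED END v3.1 FROM THE `κ := costT` WITNESS, NO DEMAND ON PRINT's CONSTANTS**:
E8T's `hybridNE7Under_of_countRoadT3bPWT_fsc` with `CountRoadWitnessT3bWT ↦ CountRoadWitnessT3bWTV` in the prefixed
hypothesis (through the owner's `toWT`); side conditions = E8T's (`hθ : 0 < θ`, `hslack : C.a + θ ≤ ½γ₀A₁²`, NO `hθJ`);
conclusion identical.  CONDITIONAL; NE7b NOT proved. [folklore] -/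
theorem hybridNE7Under_of_countRoadT3bPWTV_fsc (D : FiniteEpsData F G) (hM : D.AvgMeasurable)
    (hsign : B16.SignConventions D.C)
    {C : T4PrintedShapeBanking.Consts} {O : PrintedO1s}
    {rr : ℕ} {β₀ : ℝ} (h : ThresholdOK C F.L rr β₀) (hμ : 0 < C.μ) (d n : ℕ)
    (hκ₁ : (d : ℝ) * Real.log F.L + 2 * Real.log 2 ≤ C.κ₁) (hE₀ : Real.log (2 + birthMass C) ≤ C.E₀)
    (hA₀ : 1 ≤ C.A₀) (hβ₀ : 0 < β₀) (hLβ : (F.L : ℝ) * β₀ ≤ 1) (hn₁ : 13 ≤ C.n₁) (hn : 0 < n)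
    {θ : ℝ} (hθ : 0 < θ) (hslack : C.a + θ ≤ O.γ₀ * O.A₁ ^ 2 / 2)
    (hE₂ : 0 < C.E₂) (hE₃ : 0 ≤ C.E₃) {sS : ℕ} (hsS : 1 ≤ sS)
    (hsmall : (((2 * cth 32 1 sS + 1) ^ d : ℕ) : ℝ) * (5 : ℝ) ^ d * ((max 1 (2 * 32 + 2) : ℕ) : ℝ) ≤
      (F.L : ℝ) ^ (sS / 2) / 2)
    {θc : ℝ} (hθc0 : 0 ≤ θc) (hθc1 : θc < 1) (hθcs : 1 / 2 ≤ θc ^ sS)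
    (hData : T4ContinuumYM4Torus.ForSmallCouplings D fun g₀ => ∀ os : List (ULoop F),
        ∃ (ι α π : Type) (_ : DecidableEq ι) (_ : DecidableEq α) (_ : DecidableEq π),
          Nonempty (CountRoadWitnessT3bWTV D C O rr d n hn g₀ os ι α π)) :
    T4ApexHybrid.HybridNE7Under D (BetaPertHyp D.βfun) :=
  hybridNE7Under_of_countRoadT3bPWT_fsc D hM hsign h hμ d n hκ₁ hE₀ hA₀ hβ₀ hLβ hn₁ hn hθ hslack hE₂ hE₃ hsS hsmall hθc0
    hθc1 hθcs
    (hData.mono fun g₀ hg os => by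
      obtain ⟨ι, α, π, i₁, i₂, i₃, ⟨X⟩⟩ := hg os
      exact ⟨ι, α, π, i₁, i₂, i₃, ⟨X.toWT⟩⟩)

/-- **COROLLARY: EXISTENCE** of the continuum limit of every joint expectation of unit-scale averaged loop variables
(`D.ym4_torus_continuum_limit_exists`), GIVEN the prefixed `κ := costT` witnesses — E8T's `limit_exists_of_countRoadT3bPWT_fsc`
through `toWT`.  CONDITIONAL; NE7b NOT proved. [folklore] -/
theorem limit_exists_of_countRoadT3bPWTV_fsc (D : FiniteEpsData F G) (hM : D.AvgMeasurable)
    (hsign : B16.SignConventions D.C)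
    {C : T4PrintedShapeBanking.Consts} {O : PrintedO1s}
    {rr : ℕ} {β₀ : ℝ} (h : ThresholdOK C F.L rr β₀) (hμ : 0 < C.μ) (d n : ℕ)
    (hκ₁ : (d : ℝ) * Real.log F.L + 2 * Real.log 2 ≤ C.κ₁) (hE₀ : Real.log (2 + birthMass C) ≤ C.E₀)
    (hA₀ : 1 ≤ C.A₀) (hβ₀ : 0 < β₀) (hLβ : (F.L : ℝ) * β₀ ≤ 1) (hn₁ : 13 ≤ C.n₁) (hn : 0 < n)
    {θ : ℝ} (hθ : 0 < θ) (hslack : C.a + θ ≤ O.γ₀ * O.A₁ ^ 2 / 2)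
    (hE₂ : 0 < C.E₂) (hE₃ : 0 ≤ C.E₃) {sS : ℕ} (hsS : 1 ≤ sS)
    (hsmall : (((2 * cth 32 1 sS + 1) ^ d : ℕ) : ℝ) * (5 : ℝ) ^ d * ((max 1 (2 * 32 + 2) : ℕ) : ℝ) ≤
      (F.L : ℝ) ^ (sS / 2) / 2)
    {θc : ℝ} (hθc0 : 0 ≤ θc) (hθc1 : θc < 1) (hθcs : 1 / 2 ≤ θc ^ sS)
    (hData : T4ContinuumYM4Torus.ForSmallCouplings D fun g₀ => ∀ os : List (ULoop F),
        ∃ (ι α π : Type) (_ : DecidableEq ι) (_ : DecidableEq α) (_ : DecidableEq π),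
          Nonempty (CountRoadWitnessT3bWTV D C O rr d n hn g₀ os ι α π)) :
    D.ym4_torus_continuum_limit_exists :=
  T4ApexHybrid.limit_exists_of_hybridNE7Under D hM
    (hybridNE7Under_of_countRoadT3bPWTV_fsc D hM hsign h hμ d n hκ₁ hE₀ hA₀ hβ₀ hLβ hn₁ hn hθ hslack hE₂ hE₃ hsS hsmall
      hθc0 hθc1 hθcs hData)

/-- **COROLLARY: UNIQUENESS** of the limit points (`D.ym4_torus_continuum_limit_unique`) under the same displayed data —
E8T's `limit_unique_of_countRoadT3bPWT_fsc` through `toWT`.  CONDITIONAL; NE7b NOT proved. [folklore] -/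
theorem limit_unique_of_countRoadT3bPWTV_fsc (D : FiniteEpsData F G) (hM : D.AvgMeasurable)
    (hsign : B16.SignConventions D.C)
    {C : T4PrintedShapeBanking.Consts} {O : PrintedO1s}
    {rr : ℕ} {β₀ : ℝ} (h : ThresholdOK C F.L rr β₀) (hμ : 0 < C.μ) (d n : ℕ)
    (hκ₁ : (d : ℝ) * Real.log F.L + 2 * Real.log 2 ≤ C.κ₁) (hE₀ : Real.log (2 + birthMass C) ≤ C.E₀)
    (hA₀ : 1 ≤ C.A₀) (hβ₀ : 0 < β₀) (hLβ : (F.L : ℝ) * β₀ ≤ 1) (hn₁ : 13 ≤ C.n₁) (hn : 0 < n)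
    {θ : ℝ} (hθ : 0 < θ) (hslack : C.a + θ ≤ O.γ₀ * O.A₁ ^ 2 / 2)
    (hE₂ : 0 < C.E₂) (hE₃ : 0 ≤ C.E₃) {sS : ℕ} (hsS : 1 ≤ sS)
    (hsmall : (((2 * cth 32 1 sS + 1) ^ d : ℕ) : ℝ) * (5 : ℝ) ^ d * ((max 1 (2 * 32 + 2) : ℕ) : ℝ) ≤
      (F.L : ℝ) ^ (sS / 2) / 2)
    {θc : ℝ} (hθc0 : 0 ≤ θc) (hθc1 : θc < 1) (hθcs : 1 / 2 ≤ θc ^ sS)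
    (hData : T4ContinuumYM4Torus.ForSmallCouplings D fun g₀ => ∀ os : List (ULoop F),
        ∃ (ι α π : Type) (_ : DecidableEq ι) (_ : DecidableEq α) (_ : DecidableEq π),
          Nonempty (CountRoadWitnessT3bWTV D C O rr d n hn g₀ os ι α π)) :
    D.ym4_torus_continuum_limit_unique :=
  T4ApexHybrid.limit_unique_of_hybridNE7Under D hM
    (hybridNE7Under_of_countRoadT3bPWTV_fsc D hM hsign h hμ d n hκ₁ hE₀ hA₀ hβ₀ hLβ hn₁ hn hθ hslack hE₂ hE₃ hsS hsmall
      hθc0 hθc1 hθcs hData)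

end Under

section SU

variable {F : T4Family} {N : ℕ} [NeZero N] {ℰ : LoopAverage (Matrix.specialUnitaryGroup (Fin N) ℂ)}

/-! ## §2 The four targets and the headline over the repaired END v3.1 from the `κ := costT` witness -/

/-- **THE FOUR T⁴ TARGETS FROM THE COUNT ROAD OVER THE REPAIRED END v3.1, `κ := costT` WITNESS**, for
(0.4)-block-averaged data on `SU(N)` with a measurable small-loop average — E8T's `targets_of_countRoadT3bPWT_fsc` through
`toWT`.  CONDITIONAL on (B), `BetaPertHyp` (inside the targets' own prefix) and the displayed prefixed witnesses; NE7b
NOT proved. [folklore] -/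
theorem targets_of_countRoadT3bPWTV_fsc (D : FiniteEpsData F (Matrix.specialUnitaryGroup (Fin N) ℂ))
    (hBA : D.IsBlockAveraged ℰ) (hE : ℰ.MeasurableE) (hsign : B16.SignConventions D.C)
    {C : T4PrintedShapeBanking.Consts} {O : PrintedO1s}
    {rr : ℕ} {β₀ : ℝ} (h : ThresholdOK C F.L rr β₀) (hμ : 0 < C.μ) (d n : ℕ)
    (hκ₁ : (d : ℝ) * Real.log F.L + 2 * Real.log 2 ≤ C.κ₁) (hE₀ : Real.log (2 + birthMass C) ≤ C.E₀)
    (hA₀ : 1 ≤ C.A₀) (hβ₀ : 0 < β₀) (hLβ : (F.L : ℝ) * β₀ ≤ 1) (hn₁ : 13 ≤ C.n₁) (hn : 0 < n)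
    {θ : ℝ} (hθ : 0 < θ) (hslack : C.a + θ ≤ O.γ₀ * O.A₁ ^ 2 / 2)
    (hE₂ : 0 < C.E₂) (hE₃ : 0 ≤ C.E₃) {sS : ℕ} (hsS : 1 ≤ sS)
    (hsmall : (((2 * cth 32 1 sS + 1) ^ d : ℕ) : ℝ) * (5 : ℝ) ^ d * ((max 1 (2 * 32 + 2) : ℕ) : ℝ) ≤
      (F.L : ℝ) ^ (sS / 2) / 2)
    {θc : ℝ} (hθc0 : 0 ≤ θc) (hθc1 : θc < 1) (hθcs : 1 / 2 ≤ θc ^ sS)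
    (hData : T4ContinuumYM4Torus.ForSmallCouplings D fun g₀ => ∀ os : List (ULoop F),
        ∃ (ι α π : Type) (_ : DecidableEq ι) (_ : DecidableEq α) (_ : DecidableEq π),
          Nonempty (CountRoadWitnessT3bWTV D C O rr d n hn g₀ os ι α π)) :
    D.ym4_torus_continuum_limit_exists ∧ D.ym4_torus_continuum_limit_unique ∧
      D.limit_reflectionPositive ∧ D.limit_torusCovariant :=
  targets_of_countRoadT3bPWT_fsc D hBA hE hsign h hμ d n hκ₁ hE₀ hA₀ hβ₀ hLβ hn₁ hn hθ hslack hE₂ hE₃ hsS hsmall hθc0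
    hθc1 hθcs
    (hData.mono fun g₀ hg os => by
      obtain ⟨ι, α, π, i₁, i₂, i₃, ⟨X⟩⟩ := hg os
      exact ⟨ι, α, π, i₁, i₂, i₃, ⟨X.toWT⟩⟩)

/-- **THE HEADLINE PREDICATE FROM THE COUNT ROAD OVER THE REPAIRED END v3.1, `κ := costT` WITNESS**:
`T4ContinuumYM4Torus.ContinuumYM4Torus D` for (0.4)-block-averaged data on `SU(N)` with a measurable small-loop average,
GIVEN the two pins `(B) = B16.EndStatementBPrinted D.C` and `BetaPertHyp D.βfun` BY NAME, the datum's sign conventions,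
the repaired END's INHABITED constants-only side conditions (any positive slack `θ`; `exists_consts_countRoadT3bP`), and a
`CountRoadWitnessT3bWTV` for all small-coupling tuned runs and every loop string — E8T's
`continuumYM4Torus_of_countRoadT3bPWT_fsc` through the owner's `toWT`.  No demand on print's constants: the slot
multiplicity's class-linear constant is paid at the infrared threshold's profile level, inside the coupling threshold.
The witness displays H3^NE7b at the model's booked cost; nothing of it is discharged here.  NE7b NOT proved; count 0∕9.
[folklore] -/
theorem continuumYM4Torus_of_countRoadT3bPWTV_fsc (D : FiniteEpsData F (Matrix.specialUnitaryGroup (Fin N) ℂ))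
    (hBA : D.IsBlockAveraged ℰ) (hE : ℰ.MeasurableE)
    (hB : B16.EndStatementBPrinted D.C) (hβ : BetaPertHyp D.βfun) (hsign : B16.SignConventions D.C)
    {C : T4PrintedShapeBanking.Consts} {O : PrintedO1s}
    {rr : ℕ} {β₀ : ℝ} (h : ThresholdOK C F.L rr β₀) (hμ : 0 < C.μ) (d n : ℕ)
    (hκ₁ : (d : ℝ) * Real.log F.L + 2 * Real.log 2 ≤ C.κ₁) (hE₀ : Real.log (2 + birthMass C) ≤ C.E₀)
    (hA₀ : 1 ≤ C.A₀) (hβ₀ : 0 < β₀) (hLβ : (F.L : ℝ) * β₀ ≤ 1) (hn₁ : 13 ≤ C.n₁) (hn : 0 < n)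
    {θ : ℝ} (hθ : 0 < θ) (hslack : C.a + θ ≤ O.γ₀ * O.A₁ ^ 2 / 2)
    (hE₂ : 0 < C.E₂) (hE₃ : 0 ≤ C.E₃) {sS : ℕ} (hsS : 1 ≤ sS)
    (hsmall : (((2 * cth 32 1 sS + 1) ^ d : ℕ) : ℝ) * (5 : ℝ) ^ d * ((max 1 (2 * 32 + 2) : ℕ) : ℝ) ≤
      (F.L : ℝ) ^ (sS / 2) / 2)
    {θc : ℝ} (hθc0 : 0 ≤ θc) (hθc1 : θc < 1) (hθcs : 1 / 2 ≤ θc ^ sS)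
    (hData : T4ContinuumYM4Torus.ForSmallCouplings D fun g₀ => ∀ os : List (ULoop F),
        ∃ (ι α π : Type) (_ : DecidableEq ι) (_ : DecidableEq α) (_ : DecidableEq π),
          Nonempty (CountRoadWitnessT3bWTV D C O rr d n hn g₀ os ι α π)) :
    T4ContinuumYM4Torus.ContinuumYM4Torus D :=
  continuumYM4Torus_of_countRoadT3bPWT_fsc D hBA hE hB hβ hsign h hμ d n hκ₁ hE₀ hA₀ hβ₀ hLβ hn₁ hn hθ hslack hE₂ hE₃ hsS
    hsmall hθc0 hθc1 hθcs
    (hData.mono fun g₀ hg os => by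
      obtain ⟨ι, α, π, i₁, i₂, i₃, ⟨X⟩⟩ := hg os
      exact ⟨ι, α, π, i₁, i₂, i₃, ⟨X.toWT⟩⟩)

/-! ## §3 The re-homed V-headline is at least as strong as the owner's V-headline p263890 (round trip, by name) -/

/- **FROM p263890's OWN HYPOTHESES, ITS CONCLUSION THROUGH THE REPAIRED END v3.1 (kernel-checked `example`).**  The
owner's V-headline `HistoryRealiseCellsRunApexT3bWTV.continuumYM4Torus_of_countRoadT3bWTV_fsc` (over E7T, END v3′) carries
`hθ : 0 ≤ θ`, the plain slack `hslack` AND the demand `hθJ : ΘJ(d, sS, θc) + 8·2^d·log(2d+1) ≤ θ`; the re-homed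
headline of §2 needs `0 < θ` and `hslack` only.  Since `ΘJ(d, sS, θc) ≥ 12` (every summand is a product of casts of
naturals, `5^d`, `2^d`, `log(2d+1) ≥ 0` and the positive `1∕(1 − θc)`), `hθJ` gives `0 < θ`, and §2 applies to the SAME
prefixed witness hypothesis.  Binders and conclusion are LITERALLY those of p263890's headline (hence an `example`, not a
second declaration of that statement): by name, the demand on print's constants was never needed for the V-programme's
headline.  Nothing of print asserted; NE7b NOT proved.  (`hθ : 0 ≤ θ` is kept as a binder — spelled `_hθ`,
the statement's TYPE is p263890's — but is superseded by `hθJ` and unused.) [folklore] -/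
example (D : FiniteEpsData F (Matrix.specialUnitaryGroup (Fin N) ℂ))
    (hBA : D.IsBlockAveraged ℰ) (hE : ℰ.MeasurableE)
    (hB : B16.EndStatementBPrinted D.C) (hβ : BetaPertHyp D.βfun) (hsign : B16.SignConventions D.C)
    {C : T4PrintedShapeBanking.Consts} {O : PrintedO1s}
    {rr : ℕ} {β₀ : ℝ} (h : ThresholdOK C F.L rr β₀) (hμ : 0 < C.μ) (d n : ℕ)
    (hκ₁ : (d : ℝ) * Real.log F.L + 2 * Real.log 2 ≤ C.κ₁) (hE₀ : Real.log (2 + birthMass C) ≤ C.E₀)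
    (hA₀ : 1 ≤ C.A₀) (hβ₀ : 0 < β₀) (hLβ : (F.L : ℝ) * β₀ ≤ 1) (hn₁ : 13 ≤ C.n₁) (hn : 0 < n)
    {θ : ℝ} (_hθ : 0 ≤ θ) (hslack : C.a + θ ≤ O.γ₀ * O.A₁ ^ 2 / 2)
    (hE₂ : 0 < C.E₂) (hE₃ : 0 ≤ C.E₃) {sS : ℕ} (hsS : 1 ≤ sS)
    (hsmall : (((2 * cth 32 1 sS + 1) ^ d : ℕ) : ℝ) * (5 : ℝ) ^ d * ((max 1 (2 * 32 + 2) : ℕ) : ℝ) ≤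
      (F.L : ℝ) ^ (sS / 2) / 2)
    {θc : ℝ} (hθc0 : 0 ≤ θc) (hθc1 : θc < 1) (hθcs : 1 / 2 ≤ θc ^ sS)
    (hθJ : (2 +
            ((2 * (((2 * cth 32 1 sS + 1) ^ d : ℕ) : ℝ) * ((((2 * 32 + 1) ^ d : ℕ) : ℝ) * (4 * 2 ^ d)) +
                  4 * ((((2 * cth 32 1 sS + 1) ^ d : ℕ) : ℝ) * (5 : ℝ) ^ d)) / (1 - θc) +
              2 * (2 * ((((2 * cth 32 1 sS + 1) ^ d : ℕ) : ℝ) * (5 : ℝ) ^ d))) +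
            (2 * ((0 + 2 * Real.log (2 * d + 1)) + (2 * (d : ℝ) + 2 * Real.log (2 * d + 1)) *
                  (((max 1 (2 * 32 + 2) : ℕ) : ℝ) * (2 * ((((2 * cth 32 1 sS + 1) ^ d : ℕ) : ℝ) * (5 : ℝ) ^ d)))) +
              (2 * (d : ℝ) + 2 * Real.log (2 * d + 1)) * 1 *
                (((max 1 (2 * 32 + 2) : ℕ) : ℝ) *
                    ((2 * (((2 * cth 32 1 sS + 1) ^ d : ℕ) : ℝ) * ((((2 * 32 + 1) ^ d : ℕ) : ℝ) * (4 * 2 ^ d)) +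
                        4 * ((((2 * cth 32 1 sS + 1) ^ d : ℕ) : ℝ) * (5 : ℝ) ^ d)) / (1 - θc)) +
                  4 * 2 ^ d)) +
            10) + 8 * 2 ^ d * Real.log (2 * d + 1) ≤ θ)
    (hData : T4ContinuumYM4Torus.ForSmallCouplings D fun g₀ => ∀ os : List (ULoop F),
        ∃ (ι α π : Type) (_ : DecidableEq ι) (_ : DecidableEq α) (_ : DecidableEq π),
          Nonempty (CountRoadWitnessT3bWTV D C O rr d n hn g₀ os ι α π)) :
    T4ContinuumYM4Torus.ContinuumYM4Torus D := by
  -- `_hθ : 0 ≤ θ` is superseded: the demand's left side is positive (`positivity` reads `θc < 1` for the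
  -- quotient by `1 - θc` and `hL` for the logarithm)
  have hL : 0 ≤ Real.log (2 * (d : ℝ) + 1) := Real.log_nonneg (by linarith [(Nat.cast_nonneg d : (0 : ℝ) ≤ d)])
  set Q : ℝ := (2 * (((2 * cth 32 1 sS + 1) ^ d : ℕ) : ℝ) * ((((2 * 32 + 1) ^ d : ℕ) : ℝ) * (4 * 2 ^ d)) +
      4 * ((((2 * cth 32 1 sS + 1) ^ d : ℕ) : ℝ) * (5 : ℝ) ^ d)) / (1 - θc)
  set Lg : ℝ := Real.log (2 * (d : ℝ) + 1)
  have hθ' : 0 < θ := by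
    have hbig : 0 ≤ (Q + 2 * (2 * ((((2 * cth 32 1 sS + 1) ^ d : ℕ) : ℝ) * (5 : ℝ) ^ d))) +
        (2 * ((0 + 2 * Lg) + (2 * (d : ℝ) + 2 * Lg) *
              (((max 1 (2 * 32 + 2) : ℕ) : ℝ) * (2 * ((((2 * cth 32 1 sS + 1) ^ d : ℕ) : ℝ) * (5 : ℝ) ^ d)))) +
          (2 * (d : ℝ) + 2 * Lg) * 1 * (((max 1 (2 * 32 + 2) : ℕ) : ℝ) * Q + 4 * 2 ^ d)) +
        8 * 2 ^ d * Lg := by positivity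
    linarith
  exact continuumYM4Torus_of_countRoadT3bPWTV_fsc D hBA hE hB hβ hsign h hμ d n hκ₁ hE₀ hA₀ hβ₀ hLβ hn₁ hn hθ' hslack
    hE₂ hE₃ hsS hsmall hθc0 hθc1 hθcs hData

end SU

end

end Summit.QuantumFields.BalabanUV.T4Continuum.HistoryRealiseCellsRunApexT3bPWTV
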